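import Summits.BirchSwinnertonDyer.Rank1Residual.Iwasawa.UnitCoefficientFromRiemannSum
import Literature.NumberTheory.EllipticCurves.CuspFormLFunctionLevelConductorProofs
import HarnessLib

/-!
# Class X11b = N8 (lane CLASS-CLOSURE, seat `cc-typer-3`): the certificate predicates
# `Iwasawa.UnitCoeffAt`, `X11a.MuAnZeroAt`, `Iwasawa.RiemannSumUnitCertAt` REDUCE TO ONE NEWFORM —
# the "certificate-column instantiation" plumbing for the B-5 / IWASAWA-CENSUS rows (cell `b2b-bsdres`)

HONEST FRAMING (verbatim, cell `b2b-bsdres`, run/shared/lean/b2b/bsd-rank1-residual/): the goal of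
the cell is to DELETE the COMBINATION-SHAPED residual classes for ALL analytic-rank `≤ 1` curves
over `ℚ` — "full BSD formula for every rank `≤ 1` curve in class `C`" assembled STRICTLY from
published theorems — so that the rank-`≤ 1` remainder becomes exactly the CONSTRUCTION-SHAPED
classes, which are TYPED (missing-input Props), NOT attempted; this is not "finishing BSD".
Lane CLASS-CLOSURE: prove what is provable now; shrink each hard class to its core with data; no
claim beyond stated classes. THEOREMS ONLY (no definition, no named fact, no `sorry`); nothing
booked; no label / mark changes; certificate rows are EVIDENCE / instrumentation.

## Why this file

The per-pair certificate predicates consumed by this seat's N8 kernel files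
(`ClassClosureWeightKChainLever`, `ClassClosureMinimalPair`, `ClassClosureFiveStatement`) —
iw-1's `Iwasawa.UnitCoeffAt W p n` and `Iwasawa.RiemannSumUnitCertAt W p n`, x11a's
`X11a.MuAnZeroAt W p` — quantify over EVERY level `N`, EVERY cusp form `f ∈ S₂(Γ₀(N))` with
`IsNewformOf W f` and EVERY `ϖ ∈ ℚ` with `ϖ·Ω_E = Ω⁺_f`, whereas an instrument row is computed for
ONE newform (the modular-symbol space of `E` at level `N_E`) and ONE period ratio. The gap is pure
bookkeeping, closed here with tree theorems only: two newforms of `W` have the same level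
(`IsNewformOf.level_eq_level`: strong multiplicity one, Atkin–Lehner 1970 Thm. 4, tree theorem
`IsNewform0.level_eq_of_heckeEigenvalue_eq_holds`) and are then EQUAL (`IsNewformOf.unique`: same
`q`-expansion), and `ϖ` is determined by `f` because `Ω_E > 0` (`realPeriodRat_pos_holds`). Hence:
* `periodRatio_unique` — `ϖ·Ω_E = Ω⁺_f = ϖ'·Ω_E ⇒ ϖ = ϖ'`;
* `unitCoeffAt_of_newform` — `Iwasawa.UnitCoeffAt W p n` from its instance at ONE `(f₀, ϖ₀)`;
* `muAnZeroAt_of_newform` — `X11a.MuAnZeroAt W p` from ONE `(f₀, ϖ₀)`;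
* `riemannSumUnitCertAt_of_newform` — `Iwasawa.RiemannSumUnitCertAt W p n` from ONE `(f₀, ϖ₀)`.
The statements keep "for every `L` with `IsMultPAdicLFunctionOf f₀ p (-1) L`" (resp. the split
predicate): THE Mazur–Tate–Teitelbaum function of `f₀` is unique, so an instrument that certifies a
coefficient of `ϖ₀·L₀` for the `L₀` it computes from `f₀`'s plus modular symbols certifies it for
every such `L` once `L₀` is identified as satisfying the predicate — that identification (PARI /
msfromell normalisation = the tree's `IsMultPAdicLFunctionOf`, Manin constant, `Ω⁺_f` vs `ω₁`) is the
census seats' remaining certificate-format question (MU-SPEC), not addressed here. Nothing booked.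

References: [AtkinLehner1970] Thm. 4; [DiamondShurman2005] Thm. 8.8.1–8.8.3;
[MazurTateTeitelbaum1986Invent] §I.10, §I.14; HOME/class-closure/O2/TYPER-3.md §9 (GEN 3).
-/

set_option autoImplicit false

noncomputable section

open scoped Classical MatrixGroups ModularForm

open CongruenceSubgroup WeierstrassCurve Literature.NumberTheory.EllipticCurves
  Literature.NumberTheory.EllipticCurves.ModularForms
  Literature.NumberTheory.EllipticCurves.Rank1Residual
  Literature.NumberTheory.EllipticCurves.Rank1Residual.Typed

namespace Summit.BirchSwinnertonDyer.Rank1Residual.X11b.ClassClosure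

variable (W : WeierstrassCurve ℚ) [W.IsElliptic] (p : ℕ) [Fact p.Prime]

/-- **The period ratio is determined by the newform**: `ϖ·Ω_E = Ω⁺_f = ϖ'·Ω_E` forces `ϖ = ϖ'`,
since `Ω_E > 0` (`realPeriodRat_pos_holds`). [folklore] -/
theorem periodRatio_unique {N : ℕ} {f : CuspForm (Gamma0 N) 2} {ϖ ϖ' : ℚ}
    (h : (ϖ : ℝ) * W.realPeriodRat = plusPeriod f) (h' : (ϖ' : ℝ) * W.realPeriodRat = plusPeriod f) :
    ϖ = ϖ' := by
  have hΩ : W.realPeriodRat ≠ 0 := (W.realPeriodRat_pos_holds).ne'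
  have : (ϖ : ℝ) = (ϖ' : ℝ) := mul_right_cancel₀ hΩ (h.trans h'.symm)
  exact_mod_cast this

/-- **`Iwasawa.UnitCoeffAt W p n` from ONE newform and ONE period ratio.** If `f₀ ∈ S₂(Γ₀(N₀))` is
a newform of `W` with period ratio `ϖ₀` (`ϖ₀·Ω_E = Ω⁺_{f₀}`) and the unit-coefficient statement holds
for `(f₀, ϖ₀)` — index `n` of `ϖ₀·L` for every non-split MTT function `L` of `f₀` if `E` is non-split
at `p`, index `n + 1` for every split one if split —, then it holds for every newform of `W` at
every level and every period ratio, i.e. `Iwasawa.UnitCoeffAt W p n`: any other newform has the same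
level (strong multiplicity one, `IsNewformOf.level_eq_level`) and is then equal to `f₀`
(`IsNewformOf.unique`), and `ϖ = ϖ₀` (`periodRatio_unique`). Pure bookkeeping; nothing booked.
[cite: AtkinLehner1970, Thm. 4] [cite: MazurTateTeitelbaum1986Invent, §I.14 (shape)] -/
theorem unitCoeffAt_of_newform {N₀ : ℕ} [NeZero N₀] {f₀ : CuspForm (Gamma0 N₀) 2}
    (hf₀ : IsNewformOf W f₀) {ϖ₀ : ℚ} (hϖ₀ : (ϖ₀ : ℝ) * W.realPeriodRat = plusPeriod f₀) {n : ℕ}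
    (hns : ¬ W.HasSplitMultiplicativeReductionAtPrime p →
      ∀ L : PowerSeries ℚ_[p], IsMultPAdicLFunctionOf f₀ p (-1) L →
        ‖PowerSeries.coeff n (PowerSeries.C ((ϖ₀ : ℚ) : ℚ_[p]) * L)‖ = 1)
    (hs : W.HasSplitMultiplicativeReductionAtPrime p →
      ∀ L : PowerSeries ℚ_[p], IsSplitMultPAdicLFunctionOf f₀ p L →
        ‖PowerSeries.coeff (n + 1) (PowerSeries.C ((ϖ₀ : ℚ) : ℚ_[p]) * L)‖ = 1) :
    Iwasawa.UnitCoeffAt W p n := by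
  intro N _ f hf ϖ hϖ
  obtain rfl : N = N₀ := hf.level_eq_level hf₀
  obtain rfl : f = f₀ := hf.unique hf₀
  obtain rfl : ϖ = ϖ₀ := periodRatio_unique W hϖ hϖ₀
  exact ⟨hns, hs⟩

/-- **`X11a.MuAnZeroAt W p` from ONE newform and ONE period ratio** (some unit coefficient of
`ϖ₀·L` for every MTT function `L` of `f₀` of the reduction sign's kind). Same bookkeeping as
`unitCoeffAt_of_newform`. [cite: AtkinLehner1970, Thm. 4] [cite: GreenbergVatsal2000, p. 2–3, (2) (shape)] -/
theorem muAnZeroAt_of_newform [W.IsGloballyMinimal] {N₀ : ℕ} [NeZero N₀] {f₀ : CuspForm (Gamma0 N₀) 2}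
    (hf₀ : IsNewformOf W f₀) {ϖ₀ : ℚ} (hϖ₀ : (ϖ₀ : ℝ) * W.realPeriodRat = plusPeriod f₀)
    (hns : ¬ W.HasSplitMultiplicativeReductionAtPrime p →
      ∀ L : PowerSeries ℚ_[p], IsMultPAdicLFunctionOf f₀ p (-1) L →
        ∃ n : ℕ, ‖PowerSeries.coeff n (PowerSeries.C ((ϖ₀ : ℚ) : ℚ_[p]) * L)‖ = 1)
    (hs : W.HasSplitMultiplicativeReductionAtPrime p →
      ∀ L : PowerSeries ℚ_[p], IsSplitMultPAdicLFunctionOf f₀ p L →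
        ∃ n : ℕ, ‖PowerSeries.coeff n (PowerSeries.C ((ϖ₀ : ℚ) : ℚ_[p]) * L)‖ = 1) :
    X11a.MuAnZeroAt W p := by
  intro N _ f hf ϖ hϖ
  obtain rfl : N = N₀ := hf.level_eq_level hf₀
  obtain rfl : f = f₀ := hf.unique hf₀
  obtain rfl : ϖ = ϖ₀ := periodRatio_unique W hϖ hϖ₀
  exact ⟨hns, hs⟩

/-- **`Iwasawa.RiemannSumUnitCertAt W p n` from ONE newform and ONE period ratio** (the Riemann-sum
currency of cc-typer-6's certificate theorems / iw-1's composition: a plus-symbol bound `C`, a level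
`n₀` and the exact Riemann sums for `f₀`, with the truncation inequality and `‖ϖ₀ · RS‖ = 1` at
index `n` resp. `n + 1`). Same bookkeeping. [cite: AtkinLehner1970, Thm. 4]
[cite: MazurTateTeitelbaum1986Invent, §I.10 Prop. and §I.14 (shape)] -/
theorem riemannSumUnitCertAt_of_newform {N₀ : ℕ} [NeZero N₀] {f₀ : CuspForm (Gamma0 N₀) 2}
    (hf₀ : IsNewformOf W f₀) {ϖ₀ : ℚ} (hϖ₀ : (ϖ₀ : ℝ) * W.realPeriodRat = plusPeriod f₀) {n : ℕ}
    (hns : ¬ W.HasSplitMultiplicativeReductionAtPrime p →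
        ∃ (C : ℝ) (n₀ : ℕ) (RS : ℕ → ℕ → ℚ_[p]),
          (∀ k m : ℕ, RS k m =
            ∑ᶠ ξ : rootsOfUnity (torsionOrder p) ℤ_[p], ∑ s : ZMod (p ^ m),
              (fun (m : ℕ) (a : ZMod (p ^ m)) ↦
                  (-1 : ℚ_[p]) ^ m * (ratPlusSymbol f₀ ((a.val : ℚ) / (p : ℚ) ^ m) : ℚ_[p]))
                (m + cyclotomicExponent p)
                  (PadicInt.toZModPow (m + cyclotomicExponent p) ((ξ : ℤ_[p]ˣ) : ℤ_[p]) *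
                    (cyclotomicGenerator p : ZMod (p ^ (m + cyclotomicExponent p))) ^ s.val) *
                ((s.val.choose k : ℕ) : ℚ_[p])) ∧
          (∀ (m : ℕ) (a : ZMod (p ^ m)),
            ‖(ratPlusSymbol f₀ ((a.val : ℚ) / (p : ℚ) ^ m) : ℚ_[p])‖ ≤ C) ∧
          C / ‖((n.factorial : ℕ) : ℚ_[p])‖ * (p : ℝ) ^ (-n₀ : ℤ) < ‖RS n n₀‖ ∧
          ‖((ϖ₀ : ℚ) : ℚ_[p]) * RS n n₀‖ = 1)
    (hs : W.HasSplitMultiplicativeReductionAtPrime p →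
        ∃ (C : ℝ) (n₀ : ℕ) (RS : ℕ → ℕ → ℚ_[p]),
          (∀ k m : ℕ, RS k m =
            ∑ᶠ ξ : rootsOfUnity (torsionOrder p) ℤ_[p], ∑ s : ZMod (p ^ m),
              (fun (m : ℕ) (a : ZMod (p ^ m)) ↦
                  (ratPlusSymbol f₀ ((a.val : ℚ) / (p : ℚ) ^ m) : ℚ_[p]))
                (m + cyclotomicExponent p)
                  (PadicInt.toZModPow (m + cyclotomicExponent p) ((ξ : ℤ_[p]ˣ) : ℤ_[p]) *
                    (cyclotomicGenerator p : ZMod (p ^ (m + cyclotomicExponent p))) ^ s.val) *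
                ((s.val.choose k : ℕ) : ℚ_[p])) ∧
          (∀ (m : ℕ) (a : ZMod (p ^ m)),
            ‖(ratPlusSymbol f₀ ((a.val : ℚ) / (p : ℚ) ^ m) : ℚ_[p])‖ ≤ C) ∧
          C / ‖(((n + 1).factorial : ℕ) : ℚ_[p])‖ * (p : ℝ) ^ (-n₀ : ℤ) < ‖RS (n + 1) n₀‖ ∧
          ‖((ϖ₀ : ℚ) : ℚ_[p]) * RS (n + 1) n₀‖ = 1) :
    Iwasawa.RiemannSumUnitCertAt W p n := by
  intro N _ f hf ϖ hϖ
  obtain rfl : N = N₀ := hf.level_eq_level hf₀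
  obtain rfl : f = f₀ := hf.unique hf₀
  obtain rfl : ϖ = ϖ₀ := periodRatio_unique W hϖ hϖ₀
  exact ⟨hns, hs⟩

/-- Conversely (sanity): the ∀-form specialises to any given newform datum — so the fixed-newform
and the ∀-newform certificate shapes are EQUIVALENT given one newform of `W`. [folklore] -/
theorem unitCoeffAt_iff_of_newform {N₀ : ℕ} [NeZero N₀] {f₀ : CuspForm (Gamma0 N₀) 2}
    (hf₀ : IsNewformOf W f₀) {ϖ₀ : ℚ} (hϖ₀ : (ϖ₀ : ℝ) * W.realPeriodRat = plusPeriod f₀) {n : ℕ} :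
    Iwasawa.UnitCoeffAt W p n ↔
      ((¬ W.HasSplitMultiplicativeReductionAtPrime p →
        ∀ L : PowerSeries ℚ_[p], IsMultPAdicLFunctionOf f₀ p (-1) L →
          ‖PowerSeries.coeff n (PowerSeries.C ((ϖ₀ : ℚ) : ℚ_[p]) * L)‖ = 1) ∧
      (W.HasSplitMultiplicativeReductionAtPrime p →
        ∀ L : PowerSeries ℚ_[p], IsSplitMultPAdicLFunctionOf f₀ p L →
          ‖PowerSeries.coeff (n + 1) (PowerSeries.C ((ϖ₀ : ℚ) : ℚ_[p]) * L)‖ = 1)) :=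
  ⟨fun h => h f₀ hf₀ ϖ₀ hϖ₀, fun h => unitCoeffAt_of_newform W p hf₀ hϖ₀ h.1 h.2⟩

end Summit.BirchSwinnertonDyer.Rank1Residual.X11b.ClassClosure

end
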